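import Mathlib
import Summits.KontsevichZagierPeriods.KontsevichZagierPeriods.Theorems.InverseLandauTateFamilyKernelOpenCube
import Summits.KontsevichZagierPeriods.KontsevichZagierPeriods.Theorems.InverseLandauTateFamilyKernelTateAnchor
import Summits.KontsevichZagierPeriods.KontsevichZagierPeriods.Theorems.InverseLandauTateFamilyKernelStubExactFibreTwo
import Summits.KontsevichZagierPeriods.KontsevichZagierPeriods.Theorems.InverseLandauTateFamilyKernelStubGvMoments
import Summits.KontsevichZagierPeriods.KontsevichZagierPeriods.Theorems.InverseLandauTateFamilyKernelStubGvDensity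
import Summits.KontsevichZagierPeriods.KontsevichZagierPeriods.Theorems.InverseLandauTateFamilyKernelStubGvPrimitive
import Summits.KontsevichZagierPeriods.KontsevichZagierPeriods.Theorems.InverseLandauTateFamilyKernelStubGvDivision
import Summits.KontsevichZagierPeriods.KontsevichZagierPeriods.Theorems.InverseLandauTateFamilyKernelStubGvCertificate
import Summits.KontsevichZagierPeriods.KontsevichZagierPeriods.Theorems.InverseLandauTateFamilyKernelGpClass

/-!
# Crux `TateFamilyKernel` (stmt-KontsevichZagierPeriods-9130), line `Sketch` — the LINEAR-SLOPE
# GRAPH-PENCIL CLASS is a proved sector (glue `gvClass_mem_relations`, regime (E1))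

The linear-slope graph-pencil class of the lead's skeleton of the crux
`Summit.KontsevichZagierPeriods.KontsevichZagierPeriods.Theses.InverseLandau.TateFamilyKernel`: Tate
denominator `Q = 1 − ϖ·(u(z₂) + v(z₂) z₁)` with `u ∈ ℚ[s]` and a LINEAR slope `v(s) = γ + δs`,
`u, v > 0` on `[0,1]`, `W = u + v` strictly increasing on `[0,1]`, `u < W(1)` on `[0,1]`, `W·b ≤ 1`
on `[0,1]`, and a `ϖ`-free numerator `P ∈ ℚ[z₁, z₂]` (variables `z 0 = z₁`, `z 1 = z₂`). If the
open-square fibre integrals `∫_{(0,1)²} P/Q(·, ϖ)` vanish for all `ϖ ∈ (0,b)`, then at every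
real-algebraic `ϖ₀ ∈ (0,b)` every tame cube representation of the fibre `P/Q(·, ϖ₀)` is a
Kontsevich–Zagier relation.

* `δ = 0`: this is the graph-pencil class `gpClass_mem_relations` (p150918) with `β = γ`.
* `δ ≠ 0`: the five landed links
  1. `stub_gvMoments` (p149291): polynomial test functions of `T = u(z₂) + v(z₂)z₁` are orthogonal
     to `P` (stated for a polynomial slope `v ∈ ℚ[s]`; here `v = C γ + C δ·X`);
  2. `stub_gvDensity` (p150579): on the top interval `(s₁, 1)` — where `u < W(s)` on `[0,1]`,
     which holds near `s = 1` by `u < W(1)` (hypothesis `htop`, a maximum of `u` on the compact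
     interval and continuity of `W` at `1`) — the single-branch pushforward identity
     `∫_{(s,1)} P((W(s) − u(σ))/v(σ), σ)/v(σ) dσ = 0`;
  3. `stub_gvPrimitive` (p149495): the single-branch primitive is `Rn/v^k + a(y)·log|v|`;
  4. `stub_gvDivision` (p151109): along the graph the logarithm is `log|linear|`, killed by the
     valuation argument; the factor theorem gives the twisted identity
     `v^m P = (u′ + δz₁)∂₀Ñ − v∂₁Ñ + mδÑ`;
  5. `stub_gvCertificate` (p149488): hence `P/Q = ∂₀((u′+δz₁)Ñ/D) + ∂₁(−vÑ/D)` with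
     `D = Q·v^m`, pointwise wherever `Q ≠ 0` and `v ≠ 0`;
  are closed at the fibre by `stub_exactFibreTwo` (p138200): the denominators `D(·, ϖ₀) = Q·v^m`
  are not Tate but do not vanish on the closed square, which is all the fibre-level theorem
  needs (Baker on the one-variable boundary) — exactly as for `gpClass_mem_relations`.

References: Kontsevich–Zagier 2001, §1.2. Mathlib and the landed files above only (helpers
`LinMoments.aeval_snoc_rename_castSucc`, `GvCertificate.rename_gvV_pow`, `GvCertificate.snoc_one`);
no named fact, no new definition. Helpers live in the sub-namespace `GvClass`.
-/

noncomputable section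

open MeasureTheory Set MvPolynomial
open Literature.NumberTheory.Transcendental

namespace Summit.KontsevichZagierPeriods.InverseLandau.TateFamilyKernel.Descent

namespace GvClass

/-! ### Evaluation of the linear-slope graph-pencil data at a real point `(w, ϖ)` -/

/-- **The linear slope as a polynomial**: `v = C γ + C δ·X ∈ ℚ[s]` evaluates at a real `s` to
`γ + δs` (the bridge to the polynomial-slope statements `stub_gvMoments`, `stub_gvDensity`).
[folklore] -/
theorem aeval_linSlope (γ δ : ℚ) (s : ℝ) :
    Polynomial.aeval s (Polynomial.C γ + Polynomial.C δ * Polynomial.X) = (γ : ℝ) + δ * s := by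
  rw [map_add, map_mul, Polynomial.aeval_C, Polynomial.aeval_C, Polynomial.aeval_X, eq_ratCast,
    eq_ratCast]

/-- **The slope at a real point**: `V(w, ϖ) = γ + δ w₂` for `V = γ + δ X₁ ∈ ℚ[z₁, z₂, ϖ]`.
[folklore] -/
theorem aeval_gvV (γ δ : ℚ) (w : Fin 2 → ℝ) (ϖ : ℝ) :
    aeval (Fin.snoc w ϖ : Fin (2 + 1) → ℝ) (C γ + C δ * X 1 : MvPolynomial (Fin (2 + 1)) ℚ) =
      (γ : ℝ) + δ * w 1 := by
  rw [map_add, map_mul, MvPolynomial.aeval_C, MvPolynomial.aeval_C, aeval_X, eq_ratCast,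
    eq_ratCast, GvCertificate.snoc_one]

/-- **The Tate denominator at a real point**: `Q(w, ϖ) = 1 − ϖ·(u(w₂) + (γ + δ w₂) w₁)` for
`Q = 1 − X₂·(u(X₁) + (γ + δ X₁) X₀)`. [folklore] -/
theorem aeval_gvQ (u : Polynomial ℚ) (γ δ : ℚ) (w : Fin 2 → ℝ) (ϖ : ℝ) :
    aeval (Fin.snoc w ϖ : Fin (2 + 1) → ℝ)
        (1 - X 2 * (Polynomial.aeval (X 1 : MvPolynomial (Fin (2 + 1)) ℚ) u +
          (C γ + C δ * X 1) * X 0)) =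
      1 - ϖ * (Polynomial.aeval (w 1) u + ((γ : ℝ) + δ * w 1) * w 0) := by
  have h0 : (Fin.snoc w ϖ : Fin (2 + 1) → ℝ) 0 = w 0 := rfl
  have h2 : (Fin.snoc w ϖ : Fin (2 + 1) → ℝ) 2 = ϖ := rfl
  rw [map_sub, map_one, map_mul, map_add, map_mul, aeval_gvV, aeval_X, aeval_X,
    ← Polynomial.aeval_algHom_apply, aeval_X, h0, h2, GvCertificate.snoc_one]

/-- **The Griffiths denominator at a real point**: `D(w, ϖ) = Q(w, ϖ)·(γ + δ w₂)^m` for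
`D = Q · rename castSucc (V^m)`. [folklore] -/
theorem aeval_gvD (u : Polynomial ℚ) (γ δ : ℚ) (m : ℕ) (w : Fin 2 → ℝ) (ϖ : ℝ) :
    aeval (Fin.snoc w ϖ : Fin (2 + 1) → ℝ)
        ((1 - X 2 * (Polynomial.aeval (X 1 : MvPolynomial (Fin (2 + 1)) ℚ) u +
          (C γ + C δ * X 1) * X 0)) *
          rename Fin.castSucc ((C γ + C δ * X 1 : MvPolynomial (Fin 2) ℚ) ^ m)) =
      (1 - ϖ * (Polynomial.aeval (w 1) u + ((γ : ℝ) + δ * w 1) * w 0)) *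
        ((γ : ℝ) + δ * w 1) ^ m := by
  rw [map_mul, aeval_gvQ, GvCertificate.rename_gvV_pow, map_pow, aeval_gvV]

/-- **The fibre integrand**, polynomial form versus real form:
`(rename castSucc P)/Q` at `(w, ϖ)` is `P(w)/(1 − ϖ(u(w₂) + (γ + δ w₂) w₁))` (numerator:
`LinMoments.aeval_snoc_rename_castSucc`). [folklore] -/
theorem fibre_eq (u : Polynomial ℚ) (γ δ : ℚ) (P : MvPolynomial (Fin 2) ℚ) (w : Fin 2 → ℝ)
    (ϖ : ℝ) :
    aeval (Fin.snoc w ϖ : Fin (2 + 1) → ℝ) (rename Fin.castSucc P) /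
        aeval (Fin.snoc w ϖ : Fin (2 + 1) → ℝ)
          (1 - X 2 * (Polynomial.aeval (X 1 : MvPolynomial (Fin (2 + 1)) ℚ) u +
            (C γ + C δ * X 1) * X 0)) =
      aeval w P / (1 - ϖ * (Polynomial.aeval (w 1) u + ((γ : ℝ) + δ * w 1) * w 0)) := by
  rw [aeval_gvQ, LinMoments.aeval_snoc_rename_castSucc]

/-! ### Admissibility: `Q > 0` on the closed square for `ϖ ∈ (0,b)` -/

/-- On the closed square, `0 < u(w₂) + (γ + δ w₂) w₁ ≤ u(w₂) + (γ + δ w₂)` and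
`(u + v)(w₂)·b ≤ 1`, so for `0 < ϖ < b` the Tate denominator `1 − ϖ(u(w₂) + (γ + δ w₂) w₁)` is
positive. [folklore] -/
theorem gvQ_pos {u : Polynomial ℚ} {γ δ : ℚ} {b : ℝ} (hb : 0 < b)
    (hu0 : ∀ s ∈ Icc (0 : ℝ) 1, 0 < Polynomial.aeval s u)
    (hv0 : ∀ s ∈ Icc (0 : ℝ) 1, (0 : ℝ) < γ + δ * s)
    (hub : ∀ s ∈ Icc (0 : ℝ) 1, (Polynomial.aeval s u + (γ + δ * s)) * b ≤ 1)
    {w : Fin 2 → ℝ} (hw : ∀ t, w t ∈ Icc (0 : ℝ) 1) {ϖ : ℝ} (hϖ : ϖ ∈ Ioo 0 b) :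
    0 < 1 - ϖ * (Polynomial.aeval (w 1) u + ((γ : ℝ) + δ * w 1) * w 0) := by
  have h0 := hw 0
  have hu := hu0 (w 1) (hw 1)
  have hv := hv0 (w 1) (hw 1)
  have hb1 := hub (w 1) (hw 1)
  have hT0 : 0 < Polynomial.aeval (w 1) u + ((γ : ℝ) + δ * w 1) * w 0 :=
    add_pos_of_pos_of_nonneg hu (mul_nonneg hv.le h0.1)
  have hTle : (Polynomial.aeval (w 1) u + ((γ : ℝ) + δ * w 1) * w 0) * b ≤ 1 := by
    have h2 : ((γ : ℝ) + δ * w 1) * w 0 ≤ (γ : ℝ) + δ * w 1 := mul_le_of_le_one_right hv.le h0.2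
    have h3 : Polynomial.aeval (w 1) u + ((γ : ℝ) + δ * w 1) * w 0 ≤
        Polynomial.aeval (w 1) u + ((γ : ℝ) + δ * w 1) := by linarith
    exact (mul_le_mul_of_nonneg_right h3 hb.le).trans hb1
  have hlt : ϖ * (Polynomial.aeval (w 1) u + ((γ : ℝ) + δ * w 1) * w 0) <
      b * (Polynomial.aeval (w 1) u + ((γ : ℝ) + δ * w 1) * w 0) :=
    mul_lt_mul_of_pos_right hϖ.2 hT0
  nlinarith

/-! ### The top interval -/

/-- **The top interval.** If `u < W(1)` on `[0,1]` (`W = u + v`, `v = γ + δs`), then there is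
`s₁ ∈ [0, 1)` with `u(σ) < W(s)` for all `σ ∈ [0,1]` and all `s ∈ (s₁, 1)`: take a maximum `σ₀`
of the real polynomial function `u` on the compact interval and use continuity of `W` at `1`
with `ε = W(1) − u(σ₀) > 0`. [folklore] -/
theorem exists_topInterval (u : Polynomial ℚ) (γ δ : ℚ)
    (htop : ∀ σ ∈ Icc (0 : ℝ) 1, Polynomial.aeval σ u < Polynomial.aeval 1 u + (γ + δ)) :
    ∃ s₁ : ℝ, 0 ≤ s₁ ∧ s₁ < 1 ∧ ∀ s ∈ Ioo s₁ 1, ∀ σ ∈ Icc (0 : ℝ) 1,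
      Polynomial.aeval σ u < Polynomial.aeval s u + ((γ : ℝ) + δ * s) := by
  obtain ⟨σ₀, hσ₀, hmax⟩ := (isCompact_Icc (a := (0 : ℝ)) (b := 1)).exists_isMaxOn
    (nonempty_Icc.2 zero_le_one) (Polynomial.continuous_aeval u).continuousOn
  have hW : Continuous fun s : ℝ => Polynomial.aeval s u + ((γ : ℝ) + δ * s) :=
    (Polynomial.continuous_aeval u).add (continuous_const.add (continuous_const.mul continuous_id))
  have hε : 0 < Polynomial.aeval 1 u + ((γ : ℝ) + δ) - Polynomial.aeval σ₀ u :=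
    sub_pos.2 (htop σ₀ hσ₀)
  obtain ⟨η, hη, hηW⟩ := Metric.continuousAt_iff.1 (hW.continuousAt (x := (1 : ℝ))) _ hε
  refine ⟨max 0 (1 - η), le_max_left _ _, max_lt one_pos (by linarith), fun s hs σ hσ => ?_⟩
  have hs1 : 1 - η < s := (le_max_right _ _).trans_lt hs.1
  have hd : dist s 1 < η := by
    rw [Real.dist_eq, abs_sub_comm, abs_of_pos (by linarith [hs.2])]
    linarith
  have h := hηW hd
  rw [Real.dist_eq] at h
  have hσ₀' : Polynomial.aeval σ u ≤ Polynomial.aeval σ₀ u := isMaxOn_iff.1 hmax σ hσ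
  linarith [(abs_lt.1 h).1]

end GvClass

open GvClass in
/-- **The linear-slope graph-pencil class is a proved sector of the crux** (dimension 2, regime (E1)
of the line's elementary frontier): for `u ∈ ℚ[s]` and `v = γ + δs` with `u, v > 0` on `[0,1]`,
`u + v` strictly increasing and `u < u(1)+v(1)` on `[0,1]`, every real-algebraic fibre of every
identically vanishing `P/(1 − ϖ(u(z₂) + v(z₂)z₁))`, `P ∈ ℚ[z₁,z₂]`, is an effective KZ relation.
The single-branch primitive on the top interval carries one logarithm `log|v|`; along the graph it
is `log|linear|`, eliminated by the valuation argument; the factor theorem then yields the twisted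
divergence identity and fibre-level Griffiths exactness with denominators `Q·v^m`
(`δ = 0`: `gpClass_mem_relations`; `δ ≠ 0`: `stub_gvMoments` → `stub_gvDensity` →
`stub_gvPrimitive` → `stub_gvDivision` → `stub_gvCertificate` → `stub_exactFibreTwo`).
[cite: KontsevichZagier2001, §1.2] -/
theorem gvClass_mem_relations (u : Polynomial ℚ) (γ δ : ℚ) (P : MvPolynomial (Fin 2) ℚ) (b : ℝ) (hb : 0 < b)
    (hu0 : ∀ s ∈ Icc (0 : ℝ) 1, 0 < Polynomial.aeval s u) (hv0 : ∀ s ∈ Icc (0 : ℝ) 1, (0 : ℝ) < γ + δ * s)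
    (hmono : StrictMonoOn (fun s : ℝ => Polynomial.aeval s u + (γ + δ * s)) (Icc (0 : ℝ) 1))
    (htop : ∀ σ ∈ Icc (0 : ℝ) 1, Polynomial.aeval σ u < Polynomial.aeval 1 u + (γ + δ))
    (hub : ∀ s ∈ Icc (0 : ℝ) 1, (Polynomial.aeval s u + (γ + δ * s)) * b ≤ 1)
    (hvan : ∀ ϖ ∈ Ioo 0 b, ∫ z in Set.pi Set.univ (fun _ : Fin 2 => Ioo (0 : ℝ) 1),
      aeval z P / (1 - ϖ * (Polynomial.aeval (z 1) u + (γ + δ * z 1) * z 0)) = 0)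
    (ϖ₀ : ℝ) (halg : IsAlgebraic ℚ ϖ₀) (hϖ₀ : ϖ₀ ∈ Ioo 0 b)
    (Φ : KZ.IntegralRep 2) (hΦ : Φ.IsTameCube)
    (hΦi : ∀ z ∈ KZ.cube 2, Φ.integrand z =
      aeval z P / (1 - ϖ₀ * (Polynomial.aeval (z 1) u + (γ + δ * z 1) * z 0))) :
    KZ.of Φ ∈ KZ.relations := by
  rcases eq_or_ne δ 0 with rfl | hδ
  · -- constant slope `v = γ > 0`: the graph-pencil class with `β = γ`
    simp only [Rat.cast_zero, zero_mul, add_zero] at hv0 hmono hub hvan hΦi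
    have hγ : (0 : ℚ) < γ := by exact_mod_cast hv0 0 ⟨le_rfl, zero_le_one⟩
    have hmono' : StrictMonoOn (fun s : ℝ => Polynomial.aeval s u) (Icc (0 : ℝ) 1) :=
      fun a ha c hc hac => by
        have h := hmono ha hc hac
        dsimp only at h
        linarith
    exact gpClass_mem_relations u γ P b hγ hb hu0 hmono' hub hvan ϖ₀ halg hϖ₀ Φ hΦ hΦi
  -- the slope as a polynomial `v = C γ + C δ X`, for the polynomial-slope links GV1, GV2
  obtain ⟨v, hv⟩ : ∃ v : Polynomial ℚ, ∀ s : ℝ, Polynomial.aeval s v = (γ : ℝ) + δ * s :=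
    ⟨Polynomial.C γ + Polynomial.C δ * Polynomial.X, aeval_linSlope γ δ⟩
  have hv0' : ∀ s ∈ Icc (0 : ℝ) 1, 0 < Polynomial.aeval s v := fun s hs => by
    rw [hv]
    exact hv0 s hs
  have hub' : ∀ s ∈ Icc (0 : ℝ) 1, (Polynomial.aeval s u + Polynomial.aeval s v) * b ≤ 1 :=
    fun s hs => by
      rw [hv]
      exact hub s hs
  have hmono' : StrictMonoOn (fun s : ℝ => Polynomial.aeval s u + Polynomial.aeval s v)
      (Icc (0 : ℝ) 1) := by
    simp only [hv]
    exact hmono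
  have hvan' : ∀ ϖ ∈ Ioo 0 b, ∫ z in Set.pi Set.univ (fun _ : Fin 2 => Ioo (0 : ℝ) 1),
      aeval z P / (1 - ϖ * (Polynomial.aeval (z 1) u + Polynomial.aeval (z 1) v * z 0)) = 0 :=
    fun ϖ hϖ => by
      simp only [hv]
      exact hvan ϖ hϖ
  -- (1) moments: every polynomial test function of `T = u(z₂) + v(z₂)z₁` is orthogonal to `P`
  have htest := stub_gvMoments u v P b hb hu0 hv0' hub' hvan'
  -- (2) the top interval `(s₁, 1)` and the single-branch pushforward identity on it
  obtain ⟨s₁, hs₁0, hs₁1, hs₁u⟩ := exists_topInterval u γ δ htop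
  have hden := stub_gvDensity u v P hv0' hmono' htest
  have hzero : ∀ s ∈ Ioo s₁ 1,
      ∫ σ in Ioo s 1, aeval (![(Polynomial.aeval s u + (γ + δ * s) - Polynomial.aeval σ u) /
          (γ + δ * σ), σ] : Fin 2 → ℝ) P / (γ + δ * σ) = 0 := fun s hs => by
    have h := hden s ⟨hs₁0.trans_lt hs.1, hs.2⟩ fun σ hσ => by
      rw [hv]
      exact hs₁u s hs σ hσ
    simpa only [hv] using h
  -- (3) the single-branch primitive: rational plus one logarithm `a(y) log|γ + δσ|`
  obtain ⟨Rn, k, a, hF⟩ := stub_gvPrimitive u γ δ hδ P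
  -- (4) elimination of the logarithm along the graph and the factor theorem: twisted identity
  have hvs : ∀ σ ∈ Icc s₁ 1, (γ : ℝ) + δ * σ ≠ 0 := fun σ hσ =>
    (hv0 σ ⟨hs₁0.trans hσ.1, hσ.2⟩).ne'
  have hinj : InjOn (fun s : ℝ => Polynomial.aeval s u + (γ + δ * s)) (Ioo s₁ 1) :=
    fun x hx y hy hxy =>
      hmono.injOn ⟨hs₁0.trans hx.1.le, hx.2.le⟩ ⟨hs₁0.trans hy.1.le, hy.2.le⟩ hxy
  obtain ⟨Nt, m, hN⟩ := stub_gvDivision u γ δ hδ P Rn k a s₁ hs₁1 hvs hinj hF hzero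
  -- (5) at the fibre `ϖ₀`: `Q ≠ 0`, `D = Q·V^m ≠ 0` on the closed square, and the certificate
  have hQ : ∀ w ∈ KZ.cube 2, aeval (Fin.snoc w ϖ₀ : Fin (2 + 1) → ℝ)
      (1 - X 2 * (Polynomial.aeval (X 1 : MvPolynomial (Fin (2 + 1)) ℚ) u +
        (C γ + C δ * X 1) * X 0)) ≠ 0 := fun w hw => by
    rw [aeval_gvQ]
    exact (gvQ_pos hb hu0 hv0 hub (fun t => hw t) hϖ₀).ne'
  have hD : ∀ w ∈ KZ.cube 2, aeval (Fin.snoc w ϖ₀ : Fin (2 + 1) → ℝ)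
      ((1 - X 2 * (Polynomial.aeval (X 1 : MvPolynomial (Fin (2 + 1)) ℚ) u +
        (C γ + C δ * X 1) * X 0)) *
        rename Fin.castSucc ((C γ + C δ * X 1 : MvPolynomial (Fin 2) ℚ) ^ m)) ≠ 0 :=
    fun w hw => by
      rw [aeval_gvD]
      exact mul_ne_zero (gvQ_pos hb hu0 hv0 hub (fun t => hw t) hϖ₀).ne'
        (pow_ne_zero _ (hv0 (w 1) (hw 1)).ne')
  have hcert := fun w (hw : w ∈ KZ.cube 2) =>
    stub_gvCertificate u γ δ P Nt m hN ϖ₀ w (hv0 (w 1) (hw 1)).ne' (hQ w hw)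
  -- (6) the vanishing open-square integral at `ϖ₀`, in polynomial form
  have hfun : (fun z : Fin 2 → ℝ =>
      aeval (Fin.snoc z ϖ₀ : Fin (2 + 1) → ℝ) (rename Fin.castSucc P) /
      aeval (Fin.snoc z ϖ₀ : Fin (2 + 1) → ℝ)
        (1 - X 2 * (Polynomial.aeval (X 1 : MvPolynomial (Fin (2 + 1)) ℚ) u +
          (C γ + C δ * X 1) * X 0))) =
      fun z => aeval z P / (1 - ϖ₀ * (Polynomial.aeval (z 1) u + (γ + δ * z 1) * z 0)) :=
    funext fun z => fibre_eq u γ δ P z ϖ₀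
  have hvan₀ : ∫ z in Set.pi Set.univ (fun _ : Fin 2 => Ioo (0 : ℝ) 1),
      aeval (Fin.snoc z ϖ₀ : Fin (2 + 1) → ℝ) (rename Fin.castSucc P) /
        aeval (Fin.snoc z ϖ₀ : Fin (2 + 1) → ℝ)
          (1 - X 2 * (Polynomial.aeval (X 1 : MvPolynomial (Fin (2 + 1)) ℚ) u +
            (C γ + C δ * X 1) * X 0)) = 0 := by
    rw [hfun]
    exact hvan ϖ₀ hϖ₀
  -- exactness at the fibre suffices (`stub_exactFibreTwo`, Baker on the one-variable boundary)
  refine stub_exactFibreTwo 2 ![0, 1] (rename Fin.castSucc P)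
    (1 - X 2 * (Polynomial.aeval (X 1 : MvPolynomial (Fin (2 + 1)) ℚ) u +
      (C γ + C δ * X 1) * X 0))
    ![rename Fin.castSucc
        ((Polynomial.aeval (X 1 : MvPolynomial (Fin 2) ℚ) (Polynomial.derivative u) + C δ * X 0) *
          Nt),
      rename Fin.castSucc (-((C γ + C δ * X 1) * Nt))]
    (fun _ => (1 - X 2 * (Polynomial.aeval (X 1 : MvPolynomial (Fin (2 + 1)) ℚ) u +
        (C γ + C δ * X 1) * X 0)) *
      rename Fin.castSucc ((C γ + C δ * X 1 : MvPolynomial (Fin 2) ℚ) ^ m))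
    ϖ₀ halg hQ (fun _ => hD) (fun w hw => ?_) hvan₀ Φ hΦ (fun z hz => ?_)
  · rw [Fin.sum_univ_two]
    simp only [Matrix.cons_val_zero, Matrix.cons_val_one, Fin.castSucc_zero, Fin.castSucc_one]
    exact hcert w hw
  · rw [hΦi z hz, fibre_eq]

open GvClass in
/-- The linear-slope graph-pencil class in the crux's own binders (`n = 2`, open-square
representation): an identically vanishing family `P/(1 − ϖ(u(z₂) + (γ + δz₂)z₁))` as above has
all its real-algebraic fibres `ϖ₀ ∈ (0,b)` in `KZ.relations` for every representation with domain
the open square and integrand the fibre there (tame-cube form `gvClass_mem_relations` +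
`exists_isTameCube_fibre` + `of_mem_relations_of_isTameCube`). [cite: KontsevichZagier2001, §1.2] -/
theorem gvClass_openCube_mem_relations (u : Polynomial ℚ) (γ δ : ℚ) (P : MvPolynomial (Fin 2) ℚ)
    (b : ℝ) (hb : 0 < b)
    (hu0 : ∀ s ∈ Icc (0 : ℝ) 1, 0 < Polynomial.aeval s u)
    (hv0 : ∀ s ∈ Icc (0 : ℝ) 1, (0 : ℝ) < γ + δ * s)
    (hmono : StrictMonoOn (fun s : ℝ => Polynomial.aeval s u + (γ + δ * s)) (Icc (0 : ℝ) 1))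
    (htop : ∀ σ ∈ Icc (0 : ℝ) 1, Polynomial.aeval σ u < Polynomial.aeval 1 u + (γ + δ))
    (hub : ∀ s ∈ Icc (0 : ℝ) 1, (Polynomial.aeval s u + (γ + δ * s)) * b ≤ 1)
    (hvan : ∀ ϖ ∈ Ioo 0 b, ∫ z in Set.pi Set.univ (fun _ : Fin 2 => Ioo (0 : ℝ) 1),
      aeval z P / (1 - ϖ * (Polynomial.aeval (z 1) u + (γ + δ * z 1) * z 0)) = 0)
    (ϖ₀ : ℝ) (halg : IsAlgebraic ℚ ϖ₀) (hϖ₀ : ϖ₀ ∈ Ioo 0 b)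
    (r : KZ.IntegralRep 2) (hd : r.domain = Set.pi Set.univ (fun _ : Fin 2 => Ioo (0 : ℝ) 1))
    (hi : EqOn r.integrand
      (fun z => aeval z P / (1 - ϖ₀ * (Polynomial.aeval (z 1) u + (γ + δ * z 1) * z 0)))
      r.domain) :
    KZ.of r ∈ KZ.relations := by
  have hQ : ∀ w ∈ KZ.cube 2, aeval (Fin.snoc w ϖ₀ : Fin (2 + 1) → ℝ)
      (1 - X 2 * (Polynomial.aeval (X 1 : MvPolynomial (Fin (2 + 1)) ℚ) u +
        (C γ + C δ * X 1) * X 0)) ≠ 0 := fun w hw => by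
    rw [aeval_gvQ]
    exact (gvQ_pos hb hu0 hv0 hub (fun t => hw t) hϖ₀).ne'
  obtain ⟨Φ, hΦ, hΦi⟩ := exists_isTameCube_fibre (rename Fin.castSucc P) _ halg hQ
  have hΦrel : KZ.of Φ ∈ KZ.relations :=
    gvClass_mem_relations u γ δ P b hb hu0 hv0 hmono htop hub hvan ϖ₀ halg hϖ₀ Φ hΦ
      (fun z _ => by rw [hΦi]; exact fibre_eq u γ δ P z ϖ₀)
  exact of_mem_relations_of_isTameCube hΦ hΦrel r hd
    (fun z hz => by rw [hΦi]; exact (hi hz).trans (fibre_eq u γ δ P z ϖ₀).symm)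

end Summit.KontsevichZagierPeriods.InverseLandau.TateFamilyKernel.Descent
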